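import Summits.Ventures.PercRepro.C025ProfileThinHallSteps

/-!
# THE HALL FORM `(H⁺_{q,q+1})` WITHOUT SIMPLICITY — part B: the facts about a parallel pair (night-3 g17)
For non-loops `x ≠ y` with `y ∈ cl{x}` (so `x ∈ cl{y}`, `mem_closure_singleton_symm`), `M' = M ＼ {y}` and `N = (M ／ {x}) ＼ {y}`:
the ground sets `gr M = insert y (insert x (gr N))`, `gr M' = insert x (gr N)` (`gr_eq_insert_insert`, `gr_delete_eq_insert`); for
`T ⊆ gr N` the ranks `ρ_M(T) = ρ_{M'}(T)`, `ρ_M(T ∪ {x}) = ρ_{M'}(T ∪ {x}) = ρ_N(T) + 1`, `ρ_M(T ∪ {y}) = ρ_M(T ∪ {x, y}) = ρ_M(T ∪ {x})`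
(`par_eRk_*`), and the complements of `T`, `T ∪ {x}`, `T ∪ {y}`, `T ∪ {x, y}` in `gr M` and in `gr M'` (`par_sdiff_*`).  These are the
facts used inside `profileIneq_of_parallel` (`C025ProfileThinRowStepsB`), now as standalone lemmas for the Hall form (part C).
No `def`, no `instance`, no notation.  Axioms: standard.
-/
open scoped Matroid
namespace PercRepro
open Set Finset ThmH Staged
namespace ThinGirth
variable {α : Type} [DecidableEq α] {M : Matroid α} [M.Finite]

/-! ### Facts about a parallel pair -/

omit [DecidableEq α] [M.Finite] in
/-- For non-loops `x ≠ y`, `y ∈ cl{x}` gives `x ∈ cl{y}`. -/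
theorem mem_closure_singleton_symm {x y : α} (hx : M.Indep {x}) (hy : M.Indep {y}) (hxy : x ≠ y)
    (hpar : y ∈ M.closure {x}) : x ∈ M.closure {y} := by
  by_contra hnx
  have hdep : ¬ M.Indep (insert y {x}) := by
    rw [hx.insert_indep_iff_of_notMem (by simpa using hxy.symm)]
    exact fun h => h.2 hpar
  apply hdep
  rw [Set.pair_comm, hy.insert_indep_iff_of_notMem (by simpa using hxy)]
  exact ⟨hx.subset_ground (mem_singleton x), hnx⟩

/-- The ground set of `(M ／ {x}) ＼ {y}`. -/
theorem gr_contract_delete (x y : α) : gr ((M ／ {x}) ＼ {y}) = ((gr M).erase x).erase y := by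
  rw [gr_delete, gr_contract]

/-- `gr M = insert y (insert x (gr N))` for `N = (M ／ {x}) ＼ {y}`, `x ≠ y` in the ground set. -/
theorem gr_eq_insert_insert {x y : α} (hx : x ∈ M.E) (hy : y ∈ M.E) (hxy : x ≠ y) :
    gr M = insert y (insert x (gr ((M ／ {x}) ＼ {y}))) := by
  rw [gr_contract_delete, Finset.erase_right_comm,
    Finset.insert_erase (Finset.mem_erase.2 ⟨hxy, mem_gr_of_mem_ground hx⟩),
    Finset.insert_erase (mem_gr_of_mem_ground hy)]

/-- `gr (M ＼ {y}) = insert x (gr N)`. -/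
theorem gr_delete_eq_insert {x y : α} (hx : x ∈ M.E) (hxy : x ≠ y) :
    gr (M ＼ {y}) = insert x (gr ((M ／ {x}) ＼ {y})) := by
  rw [gr_delete, gr_contract_delete, Finset.erase_right_comm,
    Finset.insert_erase (Finset.mem_erase.2 ⟨hxy, mem_gr_of_mem_ground hx⟩)]

/-- `x ∉ gr N`. -/
theorem notMem_gr_contract_delete_left (x y : α) : x ∉ gr ((M ／ {x}) ＼ {y}) := by
  rw [gr_contract_delete, Finset.erase_right_comm]
  exact Finset.notMem_erase x _

/-- `y ∉ gr N`. -/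
theorem notMem_gr_contract_delete_right (x y : α) : y ∉ gr ((M ／ {x}) ＼ {y}) := by
  rw [gr_contract_delete]
  exact Finset.notMem_erase y _

/-- A subset of `gr N` avoiding both points is a subset of `M.E ∖ {e}` for `e ∈ {x, y}`. -/
theorem coe_subset_of_subset_gr_contract_delete {x y : α} {T : Finset α} (hT : T ⊆ gr ((M ／ {x}) ＼ {y})) :
    (T : Set α) ⊆ M.E ∧ x ∉ T ∧ y ∉ T := by
  rw [gr_contract_delete] at hT
  refine ⟨?_, fun h => (Finset.mem_erase.1 (Finset.mem_erase.1 (hT h)).2).1 rfl,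
    fun h => (Finset.mem_erase.1 (hT h)).1 rfl⟩
  intro z hz
  have := hT (Finset.mem_coe.1 hz)
  rw [Finset.mem_erase, Finset.mem_erase] at this
  rw [← coe_gr]
  exact Finset.mem_coe.2 this.2.2

/-- (a) `ρ_M(T) = ρ_{M'}(T)` for `T ⊆ gr N`. -/
theorem par_eRk_T {x y : α} {T : Finset α} (hT : T ⊆ gr ((M ／ {x}) ＼ {y})) :
    M.eRk (T : Set α) = (M ＼ {y}).eRk (T : Set α) := by
  obtain ⟨hTE, -, hyT⟩ := coe_subset_of_subset_gr_contract_delete hT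
  exact (delete_singleton_eRk_eq (coe_subset_diff_singleton hTE hyT)).symm

/-- (b) `ρ_M(T ∪ {x}) = ρ_{M'}(T ∪ {x})`. -/
theorem par_eRk_insert_x {x y : α} (hx : M.Indep {x}) (hxy : x ≠ y) {T : Finset α}
    (hT : T ⊆ gr ((M ／ {x}) ＼ {y})) :
    M.eRk ((insert x T : Finset α) : Set α) = (M ＼ {y}).eRk ((insert x T : Finset α) : Set α) := by
  obtain ⟨hTE, -, hyT⟩ := coe_subset_of_subset_gr_contract_delete hT
  refine (delete_singleton_eRk_eq (coe_subset_diff_singleton ?_ ?_)).symm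
  · rw [Finset.coe_insert]
    exact insert_subset (hx.subset_ground (mem_singleton x)) hTE
  · rw [Finset.mem_insert]
    rintro (h | h)
    · exact hxy h.symm
    · exact hyT h

/-- (d) `ρ_M(T ∪ {x, y}) = ρ_M(T ∪ {x})`. -/
theorem par_eRk_insert_y_insert_x {x y : α} (hx : M.Indep {x}) (hpar : y ∈ M.closure {x}) {T : Finset α}
    (hT : T ⊆ gr ((M ／ {x}) ＼ {y})) :
    M.eRk ((insert y (insert x T) : Finset α) : Set α) = M.eRk ((insert x T : Finset α) : Set α) := by
  obtain ⟨hTE, -, -⟩ := coe_subset_of_subset_gr_contract_delete hT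
  have hxTE : ((insert x T : Finset α) : Set α) ⊆ M.E := by
    rw [Finset.coe_insert]
    exact insert_subset (hx.subset_ground (mem_singleton x)) hTE
  rw [Finset.coe_insert y, eRk_insert_eq_of_mem_closure hxTE]
  refine M.closure_subset_closure ?_ hpar
  rw [Finset.coe_insert]
  exact Set.singleton_subset_iff.2 (mem_insert x _)

/-- (c) `ρ_M(T ∪ {y}) = ρ_M(T ∪ {x})`. -/
theorem par_eRk_insert_y {x y : α} (hx : M.Indep {x}) (hy : M.Indep {y}) (hxy : x ≠ y) (hpar : y ∈ M.closure {x})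
    {T : Finset α} (hT : T ⊆ gr ((M ／ {x}) ＼ {y})) :
    M.eRk ((insert y T : Finset α) : Set α) = M.eRk ((insert x T : Finset α) : Set α) := by
  obtain ⟨hTE, -, -⟩ := coe_subset_of_subset_gr_contract_delete hT
  have hyTE : ((insert y T : Finset α) : Set α) ⊆ M.E := by
    rw [Finset.coe_insert]
    exact insert_subset (hy.subset_ground (mem_singleton y)) hTE
  have h1 : M.eRk ((insert x (insert y T) : Finset α) : Set α) = M.eRk ((insert y T : Finset α) : Set α) := by
    rw [Finset.coe_insert x, eRk_insert_eq_of_mem_closure hyTE]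
    refine M.closure_subset_closure ?_ (mem_closure_singleton_symm hx hy hxy hpar)
    rw [Finset.coe_insert]
    exact Set.singleton_subset_iff.2 (mem_insert y _)
  rw [← h1, Finset.insert_comm, par_eRk_insert_y_insert_x hx hpar hT]

/-- (e) `ρ_{M'}(T ∪ {x}) = ρ_N(T) + 1`. -/
theorem par_eRk_insert_x_eq_contract {x y : α} (hx : M.Indep {x}) (hxy : x ≠ y) {T : Finset α}
    (hT : T ⊆ gr ((M ／ {x}) ＼ {y})) :
    (M ＼ {y}).eRk ((insert x T : Finset α) : Set α) = ((M ／ {x}) ＼ {y}).eRk (T : Set α) + 1 := by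
  obtain ⟨hTE, hxT, hyT⟩ := coe_subset_of_subset_gr_contract_delete hT
  have hTx : (T : Set α) ⊆ M.E \ {x} := coe_subset_diff_singleton hTE hxT
  have hTxy : (T : Set α) ⊆ (M ／ {x}).E \ {y} := by
    rw [Matroid.contract_ground]
    exact fun z hz => ⟨hTx hz, fun h => hyT (mem_singleton_iff.1 h ▸ Finset.mem_coe.1 hz)⟩
  rw [delete_singleton_eRk_eq hTxy, contract_singleton_eRk_add_one hx hTx, ← Finset.coe_insert,
    par_eRk_insert_x hx hxy hT]

/-! ### Complements -/

/-- `gr M ∖ T = insert y (insert x (gr N ∖ T))` for `T ⊆ gr N`. -/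
theorem par_sdiff_T {x y : α} (hx : x ∈ M.E) (hy : y ∈ M.E) (hxy : x ≠ y) {T : Finset α}
    (hT : T ⊆ gr ((M ／ {x}) ＼ {y})) :
    gr M \ T = insert y (insert x (gr ((M ／ {x}) ＼ {y}) \ T)) := by
  obtain ⟨-, hxT, hyT⟩ := coe_subset_of_subset_gr_contract_delete hT
  rw [gr_eq_insert_insert hx hy hxy, Finset.insert_sdiff_of_notMem _ hyT, Finset.insert_sdiff_of_notMem _ hxT]

/-- `gr M ∖ (T ∪ {x}) = insert y (gr N ∖ T)`. -/
theorem par_sdiff_insert_x {x y : α} (hx : x ∈ M.E) (hy : y ∈ M.E) (hxy : x ≠ y) {T : Finset α}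
    (hT : T ⊆ gr ((M ／ {x}) ＼ {y})) :
    gr M \ insert x T = insert y (gr ((M ／ {x}) ＼ {y}) \ T) := by
  obtain ⟨-, -, hyT⟩ := coe_subset_of_subset_gr_contract_delete hT
  have hyxT : y ∉ insert x T := by
    rw [Finset.mem_insert]
    rintro (h | h)
    · exact hxy h.symm
    · exact hyT h
  rw [gr_eq_insert_insert hx hy hxy, Finset.insert_sdiff_of_notMem _ hyxT, Finset.insert_sdiff_insert,
    Finset.sdiff_insert, Finset.erase_eq_of_notMem (fun h => notMem_gr_contract_delete_left x y (Finset.mem_sdiff.1 h).1)]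

/-- `gr M ∖ (T ∪ {y}) = insert x (gr N ∖ T)`. -/
theorem par_sdiff_insert_y {x y : α} (hx : x ∈ M.E) (hy : y ∈ M.E) (hxy : x ≠ y) {T : Finset α}
    (hT : T ⊆ gr ((M ／ {x}) ＼ {y})) :
    gr M \ insert y T = insert x (gr ((M ／ {x}) ＼ {y}) \ T) := by
  obtain ⟨-, hxT, -⟩ := coe_subset_of_subset_gr_contract_delete hT
  have hxyT : x ∉ insert y T := by
    rw [Finset.mem_insert]
    rintro (h | h)
    · exact hxy h
    · exact hxT h
  rw [gr_eq_insert_insert hx hy hxy, Finset.insert_sdiff_insert, Finset.insert_sdiff_of_notMem _ hxyT,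
    Finset.sdiff_insert, Finset.erase_eq_of_notMem (fun h => notMem_gr_contract_delete_right x y (Finset.mem_sdiff.1 h).1)]

/-- `gr M ∖ (T ∪ {x, y}) = gr N ∖ T`. -/
theorem par_sdiff_insert_y_insert_x {x y : α} (hx : x ∈ M.E) (hy : y ∈ M.E) (hxy : x ≠ y) {T : Finset α}
    (hT : T ⊆ gr ((M ／ {x}) ＼ {y})) :
    gr M \ insert y (insert x T) = gr ((M ／ {x}) ＼ {y}) \ T := by
  have := hT
  rw [gr_eq_insert_insert hx hy hxy, Finset.insert_sdiff_insert, Finset.insert_comm y x T, Finset.insert_sdiff_insert,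
    Finset.sdiff_insert, Finset.sdiff_insert,
    Finset.erase_eq_of_notMem (fun h => notMem_gr_contract_delete_right x y (Finset.mem_sdiff.1 h).1),
    Finset.erase_eq_of_notMem (fun h => notMem_gr_contract_delete_left x y (Finset.mem_sdiff.1 h).1)]

/-- `gr M' ∖ T = insert x (gr N ∖ T)`. -/
theorem par_sdiff_delete_T {x y : α} (hx : x ∈ M.E) (hxy : x ≠ y) {T : Finset α}
    (hT : T ⊆ gr ((M ／ {x}) ＼ {y})) :
    gr (M ＼ {y}) \ T = insert x (gr ((M ／ {x}) ＼ {y}) \ T) := by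
  obtain ⟨-, hxT, -⟩ := coe_subset_of_subset_gr_contract_delete hT
  rw [gr_delete_eq_insert hx hxy, Finset.insert_sdiff_of_notMem _ hxT]

/-- `gr M' ∖ (T ∪ {x}) = gr N ∖ T`. -/
theorem par_sdiff_delete_insert_x {x y : α} (hx : x ∈ M.E) (hxy : x ≠ y) {T : Finset α}
    (hT : T ⊆ gr ((M ／ {x}) ＼ {y})) :
    gr (M ＼ {y}) \ insert x T = gr ((M ／ {x}) ＼ {y}) \ T := by
  have := hT
  rw [gr_delete_eq_insert hx hxy, Finset.insert_sdiff_insert, Finset.sdiff_insert,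
    Finset.erase_eq_of_notMem (fun h => notMem_gr_contract_delete_left x y (Finset.mem_sdiff.1 h).1)]

end ThinGirth
end PercRepro
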